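import Summits.QuantumFields.BalabanUV.T4Continuum.Support.NE7K1LinSchurLineForm
import Summits.QuantumFields.BalabanUV.T4Continuum.Support.NE7K1LinSchurLineCoords
import Summits.QuantumFields.BalabanUV.T4Continuum.Support.NE7K1LinFineOpWeight
import Summits.QuantumFields.BalabanUV.T4Continuum.Support.NE7K1LinBlockCoords
import Literature.MathematicalPhysics.QuantumFieldTheory.Balaban1983to89.B4Thm110ZeroBox

/-!
# NE7K1LinSchurLineU1 — row NE7 (node U5), candidate route HOM, path H1L, cell K1-lin(s): the U = 1 (A = 0) TWO-CUTOFF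
# INSTANCE — for Bałaban's `A = 0` fluctuation operators of TWO runs (run A at mesh `1∕n`, run B at mesh `1∕(nL)`, run B
# Schur-complemented to run A's lattice through the one-step block means), the interpolated propagator
# `G(s) = [(1−s)·P_A + s·P_B^{Schur}]⁻¹` has kernel decay `|G(s)(x,y)| ≤ (2L^{d+1}∕min(2,a))·e^{−δ·η|x−y|_∞}` with `δ`
# INDEPENDENT OF THE MESH AND OF `s ∈ [0,1]` — hypothesis-free, every object the tree's

Lineage `b2b-balaban-t4-ne7-p2` (CRUX PROVER NE7 #2), generation 63; assembly of this generation's five pieces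
(`NE7K1LinSchurLine` p284751 — entrywise core; `NE7K1LinSchurLineForm` p285160 — form core; `NE7K1LinSchurLineCoords` p285751
— change of variables; `NE7K1LinFineOpWeight` p285983 — conjugation error of `fineOpR` at a general weight; `NE7K1LinBlockCoords`
— the block coordinates) over the B4 cell's `B4Lower18` ([Balaban1983RegularityDecay] (1.6)∕(1.8) at `A = 0`: `fineOpR n a 0 R`
= `n²(−Δ^N_R) + (a∕n^{d+1})1_{same block}` = `η^{−(d+1)}·(−Δ^η_Ω + aP_k(0))` in lattice units, coercive with `γ₀ = min(2,a)`).

THE OBJECTS (all in run A's lattice units; `R′ ⊂ ℤ^{d+1}` = run B's fine region, a union of `nL`-blocks; `R = R′.image (blk L)`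
= run A's fine region = the `L`-block labels, a union of `n`-blocks — `isBlockUnion_coarse`):
* `P_A := fineOpR n a 0 R` — run A's step operator `−Δ^{η_A} + aP_j(0)`, `η_A = 1∕n` (`n = L^j`);
* `M := fineOpR (n·L) a 0 R′` — run B's step operator `−Δ^{η_B} + aP_{j+1}(0)`, `η_B = η_A∕L`, ONE MORE averaging level;
* `H_B := (L^{d+1})⁻¹·Tᵀ M T` — `M` in the block coordinates `(V, ψ)` of `NE7K1LinBlockCoords.coordT` (V = one-step block
  means = Bałaban's `Q₁φ′` at `A = 0`, ψ = in-block fluctuations; `(L^{d+1})⁻¹` = the ratio `η_B^{d+1}∕η_A^{d+1}` of the two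
  Riemann sums, so that both quadratic forms are `η_A^{−(d+1)}`× the physical ones); its Schur complement over ψ,
  `P_B^{Schur} = A₁ − BD⁻¹C` (blocks of `H_B`), is run B's EFFECTIVE quadratic form on run A's lattice — H1L's «run B after ONE
  exact block step» at `U = 1`;
* `twoCutoffLine s := (1−s)·P_A + s·P_B^{Schur}` (`NE7K1LinSchurLineForm.lineOpR`).

THE THEOREM **`twoCutoff_inv_decay`**: for `a > 0`, every mesh `n ≥ 1`, every refinement factor `L ≥ 1`, every such region,
every `0 ≤ δ ≤ 1` with `2·(2(d+1)δ²L² + a(e^δ − 1)) ≤ min(2,a)∕(2L^{d+1})` — a window in which the mesh does NOT appear — and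
every `s ∈ [0,1]`: `twoCutoffLine s` is invertible and `|(twoCutoffLine s)⁻¹(x,y)| ≤ (2L^{d+1}∕min(2,a))·e^{−δ·(1∕n)|x−y|_∞}`.
Route: `NE7K1LinSchurLineForm.lineOpR_inv_decay_form` with the common floor `σ = min(2,a)∕L^{d+1}` (`B4Lower18.lower18_zero` for
both runs; `NE7K1LinSchurLineCoords.coercive_congr` + `NE7K1LinBlockCoords.dot_le_coordT` for run B) and the weight
`ρ = δ·edistR n R (site ·) y` pulled back block-constantly to run B's lattice (`NE7K1LinFineOpWeight.conjError_fineOpR_ge` for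
both runs — for run B at bond oscillation `δL·η_B` because block labels of fine neighbours differ by at most one,
`supNorm_blk_sub_blk_le_one`; `NE7K1LinSchurLineCoords.conjError_congr_ge` + `NE7K1LinBlockCoords.coordT_compat ∕ coordT_le_dot`).

HONEST FRAMING: this is the FIRST kernel object in the tree that carries TWO cutoffs at once with a uniform estimate — at the
GAUSSIAN, `A = 0` level only: no background field, no gauge group, no minimisers, no R-operation; the L^∞-regularity half of
(1.10) and the multi-scale (1.7) factor are not here (template, PARAMETRIC); the rate window is explicit but not optimised.
[folklore] over the tree's B4 certificates; nothing printed asserted; no `sorry`.  FIXED FINITE T⁴, rung (B)+1; NE7 NOT PRINTED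
∕ NOT PROVED; spine 0∕9; NOT infinite volume, NOT mass gap, NOT Clay.  HONEST DEPENDENCY: continuum YM on T⁴ ⇐ BetaPertH ∧
nine spine estimates (0/9 proved); BetaPertH ⇐ (D1) ∧ (D4) ∧ CAP+tail; G-an2-4 gates asym, D1 and NE2/3/4.
-/

noncomputable section

open Finset Matrix

namespace Summit.QuantumFields.BalabanUV.T4Continuum.NE7K1LinSchurLineU1

open Literature.MathematicalPhysics.QuantumFieldTheory.Balaban1983to89
open Literature.MathematicalPhysics.QuantumFieldTheory.Balaban1983to89.B4ContourShift (supNorm supNorm_nonneg abs_le_supNorm)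
open Literature.MathematicalPhysics.QuantumFieldTheory.Balaban1983to89.B4Reflection242
open Literature.MathematicalPhysics.QuantumFieldTheory.Balaban1983to89.B4BoxCov237
open Literature.MathematicalPhysics.QuantumFieldTheory.Balaban1983to89.B4Lower18
open Literature.MathematicalPhysics.QuantumFieldTheory.Balaban1983to89.B4Thm110ZeroBox (blk_blk)
open Literature.MathematicalPhysics.QuantumFieldTheory.Balaban1983to89.B4Green244 (finePt)
open NE7K1LinSchurLineForm NE7K1LinSchurLineCoords NE7K1LinFineOpWeight NE7K1LinBlockCoords

variable {d : ℕ}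

/-! ### §1 Lattice facts: the two block-union structures, block labels of neighbours, the distance weight -/

/-- a union of `nL`-blocks is a union of `L`-blocks. [folklore] -/
theorem isBlockUnion_fine {n L : ℕ} {R' : Finset (Fin (d + 1) → ℤ)} (hR' : IsBlockUnion (n * L) R') :
    IsBlockUnion L R' := by
  intro x hx z hz
  refine hR' hx ?_
  rw [Nat.mul_comm, ← blk_blk, ← blk_blk, hz]

/-- the block labels `R = R′.image (blk L)` of a union of `nL`-blocks form a union of `n`-blocks (run A's region). [folklore] -/
theorem isBlockUnion_coarse {n L : ℕ} (hL : 1 ≤ L) {R' : Finset (Fin (d + 1) → ℤ)} (hR' : IsBlockUnion (n * L) R') :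
    IsBlockUnion n (R'.image (blk L)) := by
  haveI : NeZero L := ⟨by omega⟩
  intro x hx z hz
  obtain ⟨x', hx', rfl⟩ := Finset.mem_image.1 hx
  have hz' : finePt L z 0 ∈ R' := by
    refine hR' hx' ?_
    rw [Nat.mul_comm, ← blk_blk, ← blk_blk, blk_finePt hL, hz]
  exact Finset.mem_image.2 ⟨finePt L z 0, hz', blk_finePt hL z 0⟩

/-- `|a∕L − b∕L| ≤ 1` for integers at distance `≤ 1` (`L ≥ 1`, floor division). [folklore] -/
theorem abs_ediv_sub_ediv_le_one {L : ℕ} (hL : 1 ≤ L) {a b : ℤ} (h : |a - b| ≤ 1) : |a / (L : ℤ) - b / (L : ℤ)| ≤ 1 := by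
  have hL0 : (0 : ℤ) < L := by exact_mod_cast hL
  have hab := abs_le.1 h
  have h1 : a / (L : ℤ) ≤ (b + L) / (L : ℤ) := Int.ediv_le_ediv hL0 (by omega)
  have h2 : (b - L) / (L : ℤ) ≤ a / (L : ℤ) := Int.ediv_le_ediv hL0 (by omega)
  have h3 : (b + L) / (L : ℤ) = b / (L : ℤ) + 1 := by
    rw [show b + (L : ℤ) = b + 1 * (L : ℤ) by ring, Int.add_mul_ediv_right _ _ hL0.ne']
  have h4 : (b - L) / (L : ℤ) = b / (L : ℤ) - 1 := by
    rw [show b - (L : ℤ) = b + (-1) * (L : ℤ) by ring, Int.add_mul_ediv_right _ _ hL0.ne']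
    ring
  rw [h3] at h1
  rw [h4] at h2
  exact abs_le.2 ⟨by linarith, by linarith⟩

/-- block labels of fine points at sup-distance `≤ 1` are at sup-distance `≤ 1`. [folklore] -/
theorem supNorm_blk_sub_blk_le_one {L : ℕ} (hL : 1 ≤ L) {x y : Fin (d + 1) → ℤ} (h : supNorm (x - y) ≤ 1) :
    supNorm (blk L x - blk L y) ≤ 1 := by
  refine supNorm_le_of_forall fun i => ?_
  have hi : ((|(x - y) i| : ℤ) : ℝ) ≤ 1 := (abs_le_supNorm (x - y) i).trans h
  have hi' : |x i - y i| ≤ 1 := by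
    have : ((|x i - y i| : ℤ) : ℝ) ≤ 1 := by simpa [Pi.sub_apply] using hi
    exact_mod_cast this
  have := abs_ediv_sub_ediv_le_one hL hi'
  simp only [Pi.sub_apply, blk]
  exact_mod_cast this

/-- the distance weight is `(1∕n)`-Lipschitz in the sup-norm: `|edistR x y₀ − edistR z y₀| ≤ (1∕n)·|x − z|_∞`. [folklore] -/
theorem abs_edistR_sub_le {n : ℕ} {R : Finset (Fin (d + 1) → ℤ)} (x z y₀ : ↥R) :
    |edistR n R x y₀ - edistR n R z y₀| ≤ (1 / (n : ℝ)) * supNorm (x.1 - z.1) := by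
  have hn : (0 : ℝ) ≤ 1 / (n : ℝ) := by positivity
  simp only [edistR, ← mul_sub, abs_mul, abs_of_nonneg hn]
  refine mul_le_mul_of_nonneg_left (abs_sub_le_iff.2 ⟨?_, ?_⟩) hn
  · have := supNorm_add_le (x.1 - z.1) (z.1 - y₀.1)
    rw [sub_add_sub_cancel] at this
    linarith
  · have h3 := supNorm_add_le (z.1 - x.1) (x.1 - y₀.1)
    rw [sub_add_sub_cancel] at h3
    have h4 : supNorm (z.1 - x.1) = supNorm (x.1 - z.1) := by rw [← neg_sub, B4TorusKernel.supNorm_neg]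
    linarith

/-! ### §2 The two runs' operators and the line -/

section TwoCutoff

variable {n L : ℕ} [NeZero L] {R' : Finset (Fin (d + 1) → ℤ)}

/-- run A's step operator at `A = 0`: `P_A = fineOpR n a 0 R`, `R = R′.image (blk L)`. [folklore] -/
def runA (n L : ℕ) (a : ℝ) (R' : Finset (Fin (d + 1) → ℤ)) : Matrix ↥(R'.image (blk L)) ↥(R'.image (blk L)) ℝ :=
  fineOpR n a 0 (R'.image (blk L))

/-- run B's step operator in block coordinates: `H_B = (L^{d+1})⁻¹·Tᵀ·fineOpR (nL) a 0 R′·T`. [folklore] -/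
def runB (hR'L : IsBlockUnion L R') (n : ℕ) (a : ℝ) :
    Matrix (↥(R'.image (blk L)) ⊕ (↥(R'.image (blk L)) × NZ d L)) (↥(R'.image (blk L)) ⊕ (↥(R'.image (blk L)) × NZ d L)) ℝ :=
  (((L : ℝ) ^ (d + 1))⁻¹) • ((coordT hR'L)ᵀ * fineOpR (n * L) a 0 R' * coordT hR'L)

/-- **THE TWO-CUTOFF LINE** `(1−s)·P_A + s·P_B^{Schur}`, `P_B^{Schur}` = the Schur complement of `H_B` over the in-block
fluctuations (run B's effective form on run A's lattice). [folklore] -/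
def twoCutoffLine (hR'L : IsBlockUnion L R') (n : ℕ) (a s : ℝ) : Matrix ↥(R'.image (blk L)) ↥(R'.image (blk L)) ℝ :=
  lineOpR (runA n L a R') (runB hR'L n a).toBlocks₁₁ (runB hR'L n a).toBlocks₁₂ (runB hR'L n a).toBlocks₂₁
    (runB hR'L n a).toBlocks₂₂ s

/-- **THE U = 1 TWO-CUTOFF INSTANCE OF K1-lin(s): MESH- AND `s`-UNIFORM KERNEL DECAY.**  For `a > 0`, `n ≥ 1`, `R′` a union of
`nL`-blocks, `0 ≤ δ ≤ 1` with `2(2(d+1)δ²L² + a(e^δ − 1)) ≤ min(2,a)∕(2L^{d+1})` and `s ∈ [0,1]`: the line is invertible and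
`|(twoCutoffLine s)⁻¹(x,y)| ≤ (2∕(min(2,a)∕L^{d+1}))·e^{−δ·edistR n R x y}` (`edistR n R x y = (1∕n)|x − y|_∞` = the physical
sup-distance), every constant independent of `n` and of `s`. [folklore] -/
theorem twoCutoff_inv_decay (hn : 1 ≤ n) (hR' : IsBlockUnion (n * L) R') {a δ : ℝ} (ha : 0 < a) (hδ0 : 0 ≤ δ) (hδ1 : δ ≤ 1)
    (hsmall : 2 * (2 * ((d : ℝ) + 1) * (δ * L) ^ 2 + a * (Real.exp δ - 1)) ≤ (min 2 a / (L : ℝ) ^ (d + 1)) / 2)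
    {s : ℝ} (hs0 : 0 ≤ s) (hs1 : s ≤ 1) (x y : ↥(R'.image (blk L))) :
    IsUnit (twoCutoffLine (isBlockUnion_fine hR') n a s).det ∧
      |(twoCutoffLine (isBlockUnion_fine hR') n a s)⁻¹ x y| ≤
        2 / (min 2 a / (L : ℝ) ^ (d + 1)) * Real.exp (-(δ * edistR n (R'.image (blk L)) x y)) := by
  classical
  have hL : 1 ≤ L := NeZero.one_le
  have hR'L : IsBlockUnion L R' := isBlockUnion_fine hR'
  have hRc : IsBlockUnion n (R'.image (blk L)) := isBlockUnion_coarse hL hR'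
  have hnL : 1 ≤ n * L := Nat.one_le_iff_ne_zero.2 (Nat.mul_ne_zero (Nat.one_le_iff_ne_zero.1 hn) (NeZero.ne L))
  have hn0 : (0 : ℝ) < n := by exact_mod_cast hn
  have hL0 : (0 : ℝ) < L := by exact_mod_cast hL
  have hLpow : (0 : ℝ) < (L : ℝ) ^ (d + 1) := by positivity
  have hLpow1 : (1 : ℝ) ≤ (L : ℝ) ^ (d + 1) := one_le_pow₀ (by exact_mod_cast hL)
  have hmin : 0 < min 2 a := lt_min (by norm_num) ha
  set σ : ℝ := min 2 a / (L : ℝ) ^ (d + 1) with hσdef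
  have hσ : 0 < σ := div_pos hmin hLpow
  have hσle : σ ≤ min 2 a := div_le_self hmin.le hLpow1
  have hexp : 0 ≤ Real.exp δ - 1 := by linarith [Real.add_one_le_exp δ]
  -- the weight: δ × physical sup-distance to `y`, pulled back block-constantly
  set ρ : ↥(R'.image (blk L)) ⊕ (↥(R'.image (blk L)) × NZ d L) → ℝ :=
    fun c => δ * edistR n (R'.image (blk L)) (site c) y with hρ
  set ρ' : ↥R' → ℝ := fun x' => δ * edistR n (R'.image (blk L)) (rblk L R' x') y with hρ'
  -- (1) coercivity of run A
  have hP₀ : ∀ g : ↥(R'.image (blk L)) → ℝ, σ * (g ⬝ᵥ g) ≤ g ⬝ᵥ (runA n L a R').mulVec g := by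
    intro g
    have hg : 0 ≤ g ⬝ᵥ g := by
      simp only [dotProduct]; exact Finset.sum_nonneg fun _ _ => mul_self_nonneg _
    exact (mul_le_mul_of_nonneg_right hσle hg).trans (lower18_zero hn ha.le hRc g)
  -- (2) coercivity of run B in block coordinates
  have hH₁ : ∀ u, σ * (u ⬝ᵥ u) ≤ u ⬝ᵥ (runB hR'L n a).mulVec u := by
    intro u
    have h := coercive_congr (coordT hR'L) (fineOpR (n * L) a 0 R') (c := ((L : ℝ) ^ (d + 1))⁻¹) (σM := min 2 a)
      (cT := 1) (by positivity) hmin.le (fun φ => lower18_zero hnL ha.le hR' φ) (dot_le_coordT hR'L) u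
    have hσ' : ((L : ℝ) ^ (d + 1))⁻¹ * min 2 a * 1 = σ := by rw [hσdef]; field_simp
    rw [hσ'] at h
    exact h
  -- (3) conjugation error of run A at the weight `ρ ∘ inl`
  have hbondA : ∀ x₁ x₂ : ↥(R'.image (blk L)), x₂.1 ∈ nbrs x₁.1 →
      |ρ (Sum.inl x₁) - ρ (Sum.inl x₂)| ≤ δ * (1 / (n : ℝ)) := by
    intro x₁ x₂ h12
    simp only [hρ, site, ← mul_sub, abs_mul, abs_of_nonneg hδ0]
    refine mul_le_mul_of_nonneg_left ((abs_edistR_sub_le x₁ x₂ y).trans ?_) hδ0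
    exact (mul_le_mul_of_nonneg_left (supNorm_sub_le_one_of_mem_nbrs h12) (by positivity)).trans (by rw [mul_one])
  have hblockA : ∀ x₁ x₂ : ↥(R'.image (blk L)), blk n x₁.1 = blk n x₂.1 → |ρ (Sum.inl x₁) - ρ (Sum.inl x₂)| ≤ δ := by
    intro x₁ x₂ h12
    simp only [hρ, site, ← mul_sub, abs_mul, abs_of_nonneg hδ0]
    refine (mul_le_mul_of_nonneg_left ((abs_edistR_sub_le x₁ x₂ y).trans ?_) hδ0).trans (by rw [mul_one])
    calc (1 / (n : ℝ)) * supNorm (x₁.1 - x₂.1) ≤ (1 / (n : ℝ)) * ((n : ℝ) - 1) :=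
          mul_le_mul_of_nonneg_left (supNorm_sub_le_of_blk_eq hn h12) (by positivity)
      _ ≤ 1 := by rw [div_mul_eq_mul_div, one_mul, div_le_one hn0]; linarith
  have h₀ : ∀ g : ↥(R'.image (blk L)) → ℝ, -(σ / 2) * (g ⬝ᵥ g) ≤
      ∑ j, ∑ k, (Real.exp (ρ (Sum.inl j) - ρ (Sum.inl k)) - 1) * runA n L a R' j k * (g j * g k) := by
    intro g
    have hδn : δ * (1 / (n : ℝ)) ≤ 1 := by
      calc δ * (1 / (n : ℝ)) ≤ 1 * 1 :=
            mul_le_mul hδ1 (by rw [div_le_one hn0]; exact_mod_cast hn) (by positivity) zero_le_one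
        _ = 1 := one_mul 1
    have h := conjError_fineOpR_ge hn hRc ha.le hδn hδ0 (fun z => ρ (Sum.inl z)) hbondA hblockA g
    have hg : 0 ≤ g ⬝ᵥ g := by
      simp only [dotProduct]; exact Finset.sum_nonneg fun _ _ => mul_self_nonneg _
    have hκ : 2 * ((d : ℝ) + 1) * δ ^ 2 + a * (Real.exp δ - 1) ≤ σ / 2 := by
      have hL1 : (1 : ℝ) ≤ (L : ℝ) := by exact_mod_cast hL
      have hδL : δ ^ 2 ≤ (δ * L) ^ 2 := by
        rw [mul_pow]
        nlinarith [sq_nonneg δ, mul_nonneg (sq_nonneg δ) (by nlinarith : (0 : ℝ) ≤ (L : ℝ) ^ 2 - 1)]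
      nlinarith [mul_nonneg ha.le hexp, hδL]
    exact le_trans (by nlinarith) h
  -- (4) conjugation error of run B in block coordinates at the weight `ρ` (compatible with `ρ'`)
  have hcompat : ∀ x' c, coordT hR'L x' c ≠ 0 → ρ' x' = ρ c := by
    intro x' c h
    simp only [hρ, hρ', coordT_compat hR'L x' c h]
  have hbondB : ∀ x₁ x₂ : ↥R', x₂.1 ∈ nbrs x₁.1 → |ρ' x₁ - ρ' x₂| ≤ (δ * L) * (1 / ((n * L : ℕ) : ℝ)) := by
    intro x₁ x₂ h12
    simp only [hρ', ← mul_sub, abs_mul, abs_of_nonneg hδ0]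
    have hkey : (1 / (n : ℝ)) * supNorm ((rblk L R' x₁).1 - (rblk L R' x₂).1) ≤ 1 / (n : ℝ) := by
      have hb : supNorm ((rblk L R' x₁).1 - (rblk L R' x₂).1) ≤ 1 :=
        supNorm_blk_sub_blk_le_one hL (supNorm_sub_le_one_of_mem_nbrs h12)
      exact (mul_le_mul_of_nonneg_left hb (by positivity)).trans (by rw [mul_one])
    have h1 : |edistR n (R'.image (blk L)) (rblk L R' x₁) y - edistR n (R'.image (blk L)) (rblk L R' x₂) y| ≤ 1 / (n : ℝ) :=
      (abs_edistR_sub_le _ _ y).trans hkey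
    have hnL' : (δ * L) * (1 / ((n * L : ℕ) : ℝ)) = δ * (1 / (n : ℝ)) := by
      push_cast
      field_simp
    rw [hnL']
    exact mul_le_mul_of_nonneg_left h1 hδ0
  have hblockB : ∀ x₁ x₂ : ↥R', blk (n * L) x₁.1 = blk (n * L) x₂.1 → |ρ' x₁ - ρ' x₂| ≤ δ := by
    intro x₁ x₂ h12
    simp only [hρ', ← mul_sub, abs_mul, abs_of_nonneg hδ0]
    have hbb : blk n (rblk L R' x₁).1 = blk n (rblk L R' x₂).1 := by
      show blk n (blk L x₁.1) = blk n (blk L x₂.1)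
      rw [blk_blk, blk_blk, Nat.mul_comm]; exact h12
    refine (mul_le_mul_of_nonneg_left ((abs_edistR_sub_le _ _ y).trans ?_) hδ0).trans (by rw [mul_one])
    calc (1 / (n : ℝ)) * supNorm ((rblk L R' x₁).1 - (rblk L R' x₂).1) ≤ (1 / (n : ℝ)) * ((n : ℝ) - 1) :=
          mul_le_mul_of_nonneg_left (supNorm_sub_le_of_blk_eq hn hbb) (by positivity)
      _ ≤ 1 := by rw [div_mul_eq_mul_div, one_mul, div_le_one hn0]; linarith
  have h₁ : ∀ u, -(σ / 2) * (u ⬝ᵥ u) ≤ ∑ j, ∑ k, (Real.exp (ρ j - ρ k) - 1) * runB hR'L n a j k * (u j * u k) := by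
    intro u
    have hδn : (δ * L) * (1 / ((n * L : ℕ) : ℝ)) ≤ 1 := by
      have : (δ * L) * (1 / ((n * L : ℕ) : ℝ)) = δ * (1 / (n : ℝ)) := by push_cast; field_simp
      rw [this]
      calc δ * (1 / (n : ℝ)) ≤ 1 * 1 :=
            mul_le_mul hδ1 (by rw [div_le_one hn0]; exact_mod_cast hn) (by positivity) zero_le_one
        _ = 1 := one_mul 1
    have hM := conjError_fineOpR_ge hnL hR' ha.le hδn hδ0 ρ' hbondB hblockB
    have h := conjError_congr_ge (coordT hR'L) (fineOpR (n * L) a 0 R') (c := ((L : ℝ) ^ (d + 1))⁻¹)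
      (κM := 2 * ((d : ℝ) + 1) * (δ * L) ^ 2 + a * (Real.exp δ - 1)) (CT := (L : ℝ) ^ (d + 1) + 1) (by positivity)
      (by nlinarith [mul_nonneg ha.le hexp, sq_nonneg (δ * L)]) ρ ρ' hcompat
      hM (coordT_le_dot hR'L) u
    have hu : 0 ≤ u ⬝ᵥ u := by
      simp only [dotProduct]; exact Finset.sum_nonneg fun _ _ => mul_self_nonneg _
    have hcC : ((L : ℝ) ^ (d + 1))⁻¹ * ((L : ℝ) ^ (d + 1) + 1) ≤ 2 := by
      rw [inv_mul_eq_div, div_le_iff₀ hLpow]; linarith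
    have hκ : ((L : ℝ) ^ (d + 1))⁻¹ * (2 * ((d : ℝ) + 1) * (δ * L) ^ 2 + a * (Real.exp δ - 1)) *
        ((L : ℝ) ^ (d + 1) + 1) ≤ σ / 2 := by
      have hk0 : 0 ≤ 2 * ((d : ℝ) + 1) * (δ * L) ^ 2 + a * (Real.exp δ - 1) := by
        nlinarith [mul_nonneg ha.le hexp, sq_nonneg (δ * L)]
      calc ((L : ℝ) ^ (d + 1))⁻¹ * (2 * ((d : ℝ) + 1) * (δ * L) ^ 2 + a * (Real.exp δ - 1)) * ((L : ℝ) ^ (d + 1) + 1)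
          = (((L : ℝ) ^ (d + 1))⁻¹ * ((L : ℝ) ^ (d + 1) + 1)) *
              (2 * ((d : ℝ) + 1) * (δ * L) ^ 2 + a * (Real.exp δ - 1)) := by ring
        _ ≤ 2 * (2 * ((d : ℝ) + 1) * (δ * L) ^ 2 + a * (Real.exp δ - 1)) := mul_le_mul_of_nonneg_right hcC hk0
        _ ≤ σ / 2 := hsmall
    exact le_trans (by nlinarith) h
  -- (5) assemble through the form theorem (H_B = fromBlocks of its blocks)
  have hHB : fromBlocks (runB hR'L n a).toBlocks₁₁ (runB hR'L n a).toBlocks₁₂ (runB hR'L n a).toBlocks₂₁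
      (runB hR'L n a).toBlocks₂₂ = runB hR'L n a := fromBlocks_toBlocks _
  have main := lineOpR_inv_decay_form (runA n L a R') (runB hR'L n a).toBlocks₁₁ (runB hR'L n a).toBlocks₁₂
    (runB hR'L n a).toBlocks₂₁ (runB hR'L n a).toBlocks₂₂ hσ ρ hP₀ (by rw [hHB]; exact hH₁) h₀ (by rw [hHB]; exact h₁)
    hs0 hs1
  refine ⟨main.1, ?_⟩
  have hy : ρ (Sum.inl y) = 0 := by
    simp only [hρ, site, edistR, sub_self, supNorm_zero', mul_zero]
  have h := main.2 x y
  rw [hy, sub_zero] at h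
  simpa only [hρ, site, twoCutoffLine] using h

end TwoCutoff

end Summit.QuantumFields.BalabanUV.T4Continuum.NE7K1LinSchurLineU1
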